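import Summits.AtomisticToContinuum.BoseEinsteinCondensation.Theorems.BECStronglyRayleighLatticeToPeriodicBridgeMuffinTinConfinementBound

/-!
# Route `BECStronglyRayleigh`, crux `LatticeToPeriodicBridge` (stmt-AtomisticToContinuum-9674),
# line `muffin-tin-reward-supermodularity` — DOWN direction for stub S1a, pointwise:
# deep walls deplete wherever the wall-free upper condensate exceeds the well-volume share

Helper file of the crux line `muffin-tin-reward-supermodularity` (lead prover-line-stmt-AtomisticToContinuum-9674-c2-0,
`--supports stmt-AtomisticToContinuum-9674`), sequel of `…MuffinTinConfinementBound.lean`.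

The registered open stub `stub_deepWallGerm : Sig.stub_deepWallGerm := DeepWallGerm` (Defs module) asks, in the typed
geometry and EVENTUALLY in the wall height `λ`, for the `κ = 0⁺` germ of supermodularity of the two-coupling energy
`E(λ,κ)` on `{0,λ}×[0,κ₀]`; by the landed `stub_maxwellDanskin` it implies `n₀⁺(λ,0) ≤ n₀⁺(0,0)` eventually
(`deepWallsDeplete_of_germ`). This file proves the CONVERSE bookkeeping and the DOWN direction at fixed geometry:

* `DownSandwich.upperCondensate_eventually_le` — if some finite-energy state `Φ` lives in the wells (`⟨W⟩_Φ = 0`), then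
  for all `η, θ > 0`, eventually in `λ`, `n₀⁺(λ,0) ≤ (1+η)(1-w)³N + θ` (confinement bound + `λ⟨W⟩_Ψ ≤ E_v[Φ] + δ` for
  `δ`-near-minimisers of `F(λ,0,·)`);
* `DownSandwich.deepWallsDeplete_at` — hence `(1-w)³N < n₀⁺(0,0)` (as `ofReal`) implies `n₀⁺(λ,0) ≤ n₀⁺(0,0)` eventually;
* `DownSandwich.germ_of_upperCondensate_le` — REVERSE Danskin: `n₀⁺(λ,0) ≤ n₀⁺(0,0)` at fixed `λ` implies the germ
  inequality `∀ ε > 0 ∃ κ₀ > 0 ∀ κ ∈ [0,κ₀], E(λ,0) + E(0,κ) ≤ E(λ,κ) + E(0,0) + εκ` (upper Danskin at `0`, lower Danskin at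
  `λ`, both from `…MuffinTinMaxwellDanskin.lean`; no uniqueness or gap hypothesis), so that with `stub_maxwellDanskin`
  the occupation form and the energy-germ form of S1a are EQUIVALENT pointwise;
* `DownSandwich.deepWallGerm_at` — the body of `DeepWallGerm` at `(v,N,L,M,w)`, eventually in `λ`, from the two
  hypotheses `∃ Φ in the wells with E_v[Φ] < ⊤` and `(1-w)³N < n₀⁺(0,0)`.

Reading for the line (lead's census): the registered sign S1a at a given geometry is implied by — and, since
`n₀⁺(λ,0) → z_w·(lattice value) ≤ (1-w)³N`-type confinement is all the deep end offers, is morally equivalent to — a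
FLOOR on the wall-free UPPER condensate above the well-volume share `(1-w)³` (= `1/8` at the skeleton's `w = ½`). Along
the composition's sequence `(N, L_N, M_N)` such a floor is a uniform-in-`N` torus BEC floor of the consequent's strength
(upper-occupation form); the UP direction (`LatticeToPeriodicBridge_of`) turns S1a ∧ `KineticLatticeBEC` ∧ S2′ ∧
`PeriodicRigidity` into the consequent with constant `z_w c_A/8`. The packing lemma supplying `Φ` from the geometry
(one particle per well / Ruelle sub-boxes) is the subject of the next file.

References: LSSY2005 App. A (A.11); Danskin 1967 / Topkis 1978 (language); Fournais2020 (1.1)–(1.5).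
-/

noncomputable section

namespace Summit.AtomisticToContinuum.BoseEinsteinCondensation.Cruxes.LatticeToPeriodicBridge.MuffinTinRewardSupermodularity

open MeasureTheory Filter
open scoped ENNReal NNReal Topology ComplexConjugate
open Literature.MathematicalPhysics.QuantumManyBody.BoseGas
open Summit.AtomisticToContinuum.BoseEinsteinCondensation.Theses
open Summit.AtomisticToContinuum.BoseEinsteinCondensation.Theses.BECStronglyRayleigh

namespace DownSandwich

variable {N : ℕ} {L : ℝ}

/-! ## Wall mass of near-minimisers and the eventual confinement of the upper condensate -/

/-- A state living in the wells bounds `E(λ,0)` uniformly in `λ`. [folklore] -/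
theorem twoCouplingEnergy_le_of_wallEnergy_eq_zero (v : ℝ → ℝ≥0∞) (M : ℕ) (w lam : ℝ)
    (Φ : PeriodicTrialState N L) (hΦ : wallEnergy N L M w Φ.ψ = 0) :
    twoCouplingEnergy v N L M w lam 0 ≤ periodicEnergy v Φ := by
  calc twoCouplingEnergy v N L M w lam 0 ≤ twoCouplingFunctional v M w lam 0 Φ := iInf_le _ Φ
    _ = periodicEnergy v Φ := by rw [twoCouplingFunctional_kap_zero, hΦ, mul_zero, add_zero]

/-- Near-minimisers of `F(λ,0,·)` carry wall mass `λ⟨W⟩_Ψ ≤ E_v[Φ] + δ` for any state `Φ` living in the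
wells. [folklore] -/
theorem ofReal_mul_wallEnergy_le {v : ℝ → ℝ≥0∞} {M : ℕ} {w lam : ℝ} {Φ Ψ : PeriodicTrialState N L}
    (hΦ : wallEnergy N L M w Φ.ψ = 0) {δ : ℝ≥0∞}
    (hΨ : twoCouplingFunctional v M w lam 0 Ψ ≤ twoCouplingEnergy v N L M w lam 0 + δ) :
    ENNReal.ofReal lam * wallEnergy N L M w Ψ.ψ ≤ periodicEnergy v Φ + δ := by
  calc ENNReal.ofReal lam * wallEnergy N L M w Ψ.ψ ≤ twoCouplingFunctional v M w lam 0 Ψ := by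
        rw [twoCouplingFunctional_kap_zero]; exact le_add_self
    _ ≤ twoCouplingEnergy v N L M w lam 0 + δ := hΨ
    _ ≤ periodicEnergy v Φ + δ := add_le_add (twoCouplingEnergy_le_of_wallEnergy_eq_zero v M w lam Φ hΦ) le_rfl

/-- **Eventual confinement of the upper condensate.** If some finite-energy state lives in the wells,
then for all `η, θ > 0`, eventually in `λ`: `n₀⁺(λ,0) ≤ (1+η)(1-w)³N + θ`. [folklore] -/
theorem upperCondensate_eventually_le {M : ℕ} (hM : 0 < M) (hL : 0 < L) {w : ℝ} (hw1 : w ≤ 1)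
    (v : ℝ → ℝ≥0∞) {Φ : PeriodicTrialState N L} (hΦw : wallEnergy N L M w Φ.ψ = 0)
    (hΦE : periodicEnergy v Φ ≠ ⊤) {η θ : ℝ} (hη : 0 < η) (hθ : 0 < θ) :
    ∀ᶠ lam : ℝ in atTop,
      upperCondensate v N L M w lam 0 ≤ ENNReal.ofReal ((1 + η) * (1 - w) ^ 3 * N + θ) := by
  -- the finite constant `K = (1+η⁻¹) N (E_v[Φ] + 1)`
  set K : ℝ≥0∞ := ENNReal.ofReal (1 + η⁻¹) * N * (periodicEnergy v Φ + 1) with hK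
  have hKtop : K ≠ ⊤ := ENNReal.mul_ne_top (ENNReal.mul_ne_top ENNReal.ofReal_ne_top (by simp))
    (ENNReal.add_ne_top.2 ⟨hΦE, ENNReal.one_ne_top⟩)
  filter_upwards [eventually_ge_atTop (K.toReal / θ + 1)] with lam hlam
  have hlam0 : 0 < lam := lt_of_lt_of_le (by positivity) hlam
  have hlamne : ENNReal.ofReal lam ≠ 0 := by simpa using hlam0
  -- the tail term is at most `θ`
  have htail : K / ENNReal.ofReal lam ≤ ENNReal.ofReal θ := by
    rw [ENNReal.div_le_iff hlamne ENNReal.ofReal_ne_top, ← ENNReal.ofReal_toReal hKtop,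
      ← ENNReal.ofReal_mul hθ.le]
    apply ENNReal.ofReal_le_ofReal
    have h1 : K.toReal / θ ≤ lam := by linarith
    rw [div_le_iff₀ hθ] at h1
    linarith
  -- bound every `1`-near-minimiser
  unfold upperCondensate
  refine (iInf₂_le (1 : ℝ≥0∞) one_pos).trans (iSup₂_le fun Ψ hΨ => ?_)
  have hW : wallEnergy N L M w Ψ.ψ ≤ (periodicEnergy v Φ + 1) / ENNReal.ofReal lam := by
    rw [ENNReal.le_div_iff_mul_le (Or.inl hlamne) (Or.inl ENNReal.ofReal_ne_top), mul_comm]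
    exact ofReal_mul_wallEnergy_le hΦw hΨ
  calc condensateOccupation N L Ψ.ψ
      ≤ ENNReal.ofReal ((1 + η) * (1 - w) ^ 3) * N +
          ENNReal.ofReal (1 + η⁻¹) * N * wallEnergy N L M w Ψ.ψ :=
        condensateOccupation_le_confinement hM hL hw1 hη Ψ
    _ ≤ ENNReal.ofReal ((1 + η) * (1 - w) ^ 3) * N + K / ENNReal.ofReal lam := by
        gcongr
        rw [hK, mul_div_assoc]
        exact mul_le_mul_right hW _
    _ ≤ ENNReal.ofReal ((1 + η) * (1 - w) ^ 3) * N + ENNReal.ofReal θ := add_le_add le_rfl htail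
    _ = ENNReal.ofReal ((1 + η) * (1 - w) ^ 3 * N + θ) := by
        conv_rhs => rw [ENNReal.ofReal_add (by positivity) hθ.le, ENNReal.ofReal_mul' (Nat.cast_nonneg N),
          ENNReal.ofReal_natCast]

/-- **DOWN, pointwise (occupation form).** If some finite-energy state lives in the wells and the
wall-free upper condensate exceeds the well-volume share, `(1-w)³N < n₀⁺(0,0)`, then eventually in `λ`
the muffin tin only depletes: `n₀⁺(λ,0) ≤ n₀⁺(0,0)`. [folklore] -/
theorem deepWallsDeplete_at {M : ℕ} (hM : 0 < M) (hL : 0 < L) {w : ℝ} (hw1 : w ≤ 1)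
    (v : ℝ → ℝ≥0∞) {Φ : PeriodicTrialState N L} (hΦw : wallEnergy N L M w Φ.ψ = 0)
    (hΦE : periodicEnergy v Φ ≠ ⊤)
    (hfloor : ENNReal.ofReal ((1 - w) ^ 3 * N) < upperCondensate v N L M w 0 0) :
    ∀ᶠ lam : ℝ in atTop, upperCondensate v N L M w lam 0 ≤ upperCondensate v N L M w 0 0 := by
  obtain ⟨m, hm0, h1, h2⟩ := ENNReal.lt_iff_exists_real_btwn.1 hfloor
  have hlt : (1 - w) ^ 3 * N < m := (ENNReal.ofReal_lt_ofReal_iff_of_nonneg (by positivity)).1 h1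
  set gap : ℝ := m - (1 - w) ^ 3 * N with hgap
  have hgap0 : 0 < gap := by rw [hgap]; linarith
  set η : ℝ := gap / (4 * ((1 - w) ^ 3 * N + 1)) with hη
  have hpos : 0 < (1 - w) ^ 3 * (N : ℝ) + 1 := by positivity
  have hη0 : 0 < η := by rw [hη]; positivity
  have hηle : η * ((1 - w) ^ 3 * N) ≤ gap / 4 := by
    rw [hη, div_mul_eq_mul_div, div_le_div_iff₀ (by positivity) (by norm_num)]
    nlinarith [hgap0, (by positivity : (0 : ℝ) ≤ (1 - w) ^ 3 * N)]
  have hev := upperCondensate_eventually_le hM hL hw1 v hΦw hΦE hη0 (by positivity : 0 < gap / 4)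
  filter_upwards [hev] with lam hlam
  refine hlam.trans (le_trans (ENNReal.ofReal_le_ofReal ?_) h2.le)
  nlinarith

/-! ## From the occupation form back to the energy germ (reverse Danskin) -/

/-- `E(λ,κ) ≤ E(λ,0) + κN`: the reward term costs at most `κN`. [folklore] -/
theorem twoCouplingEnergy_kap_le (v : ℝ → ℝ≥0∞) (N : ℕ) (L : ℝ) (M : ℕ) (w lam : ℝ) {kap : ℝ}
    (hkap : 0 ≤ kap) :
    twoCouplingEnergy v N L M w lam kap ≤ twoCouplingEnergy v N L M w lam 0 + ENNReal.ofReal (kap * N) := by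
  by_cases hE : twoCouplingEnergy v N L M w lam 0 = ⊤
  · rw [hE, top_add]; exact le_top
  refine ENNReal.le_of_forall_pos_le_add fun δ hδ _ => ?_
  have hδ' : (0 : ℝ≥0∞) < δ := ENNReal.coe_pos.2 hδ
  obtain ⟨Ψ, hΨ⟩ := iInf_lt_iff.1 (ENNReal.lt_add_right hE hδ'.ne')
  calc twoCouplingEnergy v N L M w lam kap ≤ twoCouplingFunctional v M w lam kap Ψ := iInf_le _ Ψ
    _ = twoCouplingFunctional v M w lam 0 Ψ +
          ENNReal.ofReal kap * ((N : ℝ≥0∞) - condensateOccupation N L Ψ.ψ) :=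
        MaxwellDanskin.twoCouplingFunctional_eq_add v M w lam kap Ψ
    _ ≤ (twoCouplingEnergy v N L M w lam 0 + δ) + ENNReal.ofReal kap * (N : ℝ≥0∞) := by
        gcongr
        · exact hΨ.le
        · exact tsub_le_self
    _ = twoCouplingEnergy v N L M w lam 0 + ENNReal.ofReal (kap * N) + δ := by
        rw [ENNReal.ofReal_mul hkap, ENNReal.ofReal_natCast, add_right_comm]

/-- `E(λ,0) ≤ E(λ,κ)` for `κ ≥ 0` (the reward-penalty term is non-negative). [folklore] -/
theorem twoCouplingEnergy_zero_le (v : ℝ → ℝ≥0∞) (N : ℕ) (L : ℝ) (M : ℕ) (w lam kap : ℝ) :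
    twoCouplingEnergy v N L M w lam 0 ≤ twoCouplingEnergy v N L M w lam kap := by
  refine le_iInf fun Ψ => (iInf_le _ Ψ).trans ?_
  rw [MaxwellDanskin.twoCouplingFunctional_eq_add v M w lam kap Ψ]
  exact le_self_add

/-- **Reverse Danskin.** If `n₀⁺(λ,0) ≤ n₀⁺(0,0)` at fixed `(v, N, L, M, w, λ)`, then the `κ = 0⁺` germ of
supermodularity of `E` on `{0, λ} × [0, κ₀]` holds with `o(κ)` slack: for every `ε > 0` there is `κ₀ > 0`
with `E(λ,0) + E(0,κ) ≤ E(λ,κ) + E(0,0) + εκ` for `0 ≤ κ ≤ κ₀`. [folklore] -/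
theorem germ_of_upperCondensate_le (v : ℝ → ℝ≥0∞) (N : ℕ) (L : ℝ) (M : ℕ) (w lam : ℝ)
    (hdep : upperCondensate v N L M w lam 0 ≤ upperCondensate v N L M w 0 0) {ε : ℝ} (hε : 0 < ε) :
    ∃ κ₀ : ℝ, 0 < κ₀ ∧ ∀ kap : ℝ, 0 ≤ kap → kap ≤ κ₀ →
      twoCouplingEnergy v N L M w lam 0 + twoCouplingEnergy v N L M w 0 kap ≤
        twoCouplingEnergy v N L M w lam kap + twoCouplingEnergy v N L M w 0 0 +
          ENNReal.ofReal (ε * kap) := by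
  set u₀ := upperCondensate v N L M w 0 0 with hu₀
  set ul := upperCondensate v N L M w lam 0 with hul
  have hu₀N : u₀ ≤ N := MaxwellDanskin.upperCondensate_le_card v N L M w 0 0
  have hu₀top : u₀ ≠ ⊤ := ne_top_of_le_ne_top (by simp) hu₀N
  have hultop : ul ≠ ⊤ := ne_top_of_le_ne_top hu₀top hdep
  -- the lower window at `λ`, above `a = ul + ε/2`
  set a : ℝ := ul.toReal + ε / 2 with ha
  have ha0 : 0 ≤ a := by positivity
  have hua : ul < ENNReal.ofReal a := by
    rw [ha, ENNReal.lt_ofReal_iff_toReal_lt hultop]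
    linarith
  obtain ⟨ηw, hηw0, hηwtop, hs⟩ := MaxwellDanskin.exists_window_of_upperCondensate_lt v N L M w lam hua
  have hηr : 0 < ηw.toReal := ENNReal.toReal_pos hηw0.ne' hηwtop
  -- the upper point `b = max (u₀ - ε/2) 0`
  set b : ℝ := max (u₀.toReal - ε / 2) 0 with hb
  have hb0 : 0 ≤ b := le_max_right _ _
  have hNab : (N : ℝ) - b ≤ (N - a) + ε := by
    have hmono : ul.toReal ≤ u₀.toReal := ENNReal.toReal_mono hu₀top hdep
    rw [hb, ha]
    rcases le_or_gt (u₀.toReal - ε / 2) 0 with h | h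
    · rw [max_eq_right h]; linarith
    · rw [max_eq_left h.le]; linarith
  -- upper Danskin at `0` (or the crude bound when `b = 0`)
  have hup : ∀ {kap : ℝ}, 0 ≤ kap →
      twoCouplingEnergy v N L M w 0 kap ≤ u₀ * 0 + twoCouplingEnergy v N L M w 0 0 +
        ENNReal.ofReal (kap * (N - b)) := by
    intro kap hkap
    rw [mul_zero, zero_add]
    rcases le_or_gt (u₀.toReal - ε / 2) 0 with h | h
    · have hb' : b = 0 := by rw [hb, max_eq_right h]
      rw [hb', sub_zero]
      exact twoCouplingEnergy_kap_le v N L M w 0 hkap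
    · have hb' : b = u₀.toReal - ε / 2 := by rw [hb, max_eq_left h.le]
      have hbu : ENNReal.ofReal b < u₀ := by
        rw [hb', ENNReal.ofReal_lt_iff_lt_toReal (by linarith) hu₀top]
        linarith
      exact MaxwellDanskin.upper_danskin v N L M w 0 hb0 hbu hkap
  refine ⟨ηw.toReal / (N + 1), div_pos hηr (by positivity), fun kap hkap hkaple => ?_⟩
  -- lower Danskin at `λ`, the window swallowing `κ(N - a)`
  have hκη : ENNReal.ofReal (kap * (N - a)) ≤ ηw := by
    rcases le_or_gt 0 ((N : ℝ) - a) with hc | hc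
    · rw [← ENNReal.ofReal_toReal hηwtop]
      apply ENNReal.ofReal_le_ofReal
      calc kap * (N - a) ≤ ηw.toReal / (N + 1) * (N + 1) :=
            mul_le_mul hkaple (by linarith) hc (by positivity)
        _ = ηw.toReal := div_mul_cancel₀ _ (by positivity)
    · rw [ENNReal.ofReal_of_nonpos (mul_nonpos_of_nonneg_of_nonpos hkap hc.le)]
      exact zero_le
  have hlow := MaxwellDanskin.lower_danskin v N L M w lam ha0 hs hkap
  rw [min_eq_right hκη] at hlow
  -- assemble
  calc twoCouplingEnergy v N L M w lam 0 + twoCouplingEnergy v N L M w 0 kap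
      ≤ twoCouplingEnergy v N L M w lam 0 +
          (twoCouplingEnergy v N L M w 0 0 + ENNReal.ofReal (kap * (N - b))) := by
        have := hup hkap
        rw [mul_zero, zero_add] at this
        gcongr
    _ ≤ twoCouplingEnergy v N L M w lam 0 +
          (twoCouplingEnergy v N L M w 0 0 + (ENNReal.ofReal (kap * (N - a)) + ENNReal.ofReal (ε * kap))) := by
        gcongr
        calc ENNReal.ofReal (kap * (N - b)) ≤ ENNReal.ofReal (kap * (N - a) + ε * kap) :=
              ENNReal.ofReal_le_ofReal (by nlinarith)
          _ ≤ _ := ENNReal.ofReal_add_le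
    _ = (twoCouplingEnergy v N L M w lam 0 + ENNReal.ofReal (kap * (N - a))) +
          twoCouplingEnergy v N L M w 0 0 + ENNReal.ofReal (ε * kap) := by ring
    _ ≤ twoCouplingEnergy v N L M w lam kap + twoCouplingEnergy v N L M w 0 0 + ENNReal.ofReal (ε * kap) := by
        gcongr

/-- **DOWN, pointwise (energy-germ form of the registered stub).** Under the hypotheses of
`deepWallsDeplete_at`, eventually in `λ` the `κ = 0⁺` germ of supermodularity of `E` on `{0,λ}×[0,κ₀]` holds
with `o(κ)` slack — the body of `DeepWallGerm` at this geometry. [folklore] -/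
theorem deepWallGerm_at {M : ℕ} (hM : 0 < M) (hL : 0 < L) {w : ℝ} (hw1 : w ≤ 1)
    (v : ℝ → ℝ≥0∞) {Φ : PeriodicTrialState N L} (hΦw : wallEnergy N L M w Φ.ψ = 0)
    (hΦE : periodicEnergy v Φ ≠ ⊤)
    (hfloor : ENNReal.ofReal ((1 - w) ^ 3 * N) < upperCondensate v N L M w 0 0) :
    ∀ᶠ lam : ℝ in atTop, ∀ ε : ℝ, 0 < ε → ∃ κ₀ : ℝ, 0 < κ₀ ∧
      ∀ kap : ℝ, 0 ≤ kap → kap ≤ κ₀ →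
        twoCouplingEnergy v N L M w lam 0 + twoCouplingEnergy v N L M w 0 kap ≤
          twoCouplingEnergy v N L M w lam kap + twoCouplingEnergy v N L M w 0 0 + ENNReal.ofReal (ε * kap) := by
  filter_upwards [deepWallsDeplete_at hM hL hw1 v hΦw hΦE hfloor] with lam hlam
  exact fun ε hε => germ_of_upperCondensate_le v N L M w lam hlam hε

end DownSandwich

/-- **Registered sub-goal `downSandwich_deepWallGermAt`** (lead's DOWN direction for `stub_deepWallGerm`, pointwise):
at a fixed geometry `(v, N, L, M, w)` with `M ≥ 1`, `L > 0`, `w ≤ 1`, if some periodic trial state `Φ` lives in the wells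
(`⟨W⟩_Φ = 0`) with finite energy and the wall-free upper condensate exceeds the well-volume share, `(1-w)³N < n₀⁺(0,0)`,
then EVENTUALLY in `λ` the `κ = 0⁺` germ of supermodularity of `E` on `{0,λ}×[0,κ₀]` holds with `o(κ)` slack — the body of
`DeepWallGerm` at this geometry. [folklore] -/
theorem downSandwich_deepWallGermAt :
    ∀ (N : ℕ) (L : ℝ) (M : ℕ), 0 < M → 0 < L → ∀ (w : ℝ), w ≤ 1 →
      ∀ (v : ℝ → ENNReal) (Φ : PeriodicTrialState N L), wallEnergy N L M w Φ.ψ = 0 →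
        periodicEnergy v Φ ≠ ⊤ →
        ENNReal.ofReal ((1 - w) ^ 3 * N) < upperCondensate v N L M w 0 0 →
          ∀ᶠ lam : ℝ in Filter.atTop, ∀ ε : ℝ, 0 < ε → ∃ κ₀ : ℝ, 0 < κ₀ ∧
            ∀ kap : ℝ, 0 ≤ kap → kap ≤ κ₀ →
              twoCouplingEnergy v N L M w lam 0 + twoCouplingEnergy v N L M w 0 kap ≤
                twoCouplingEnergy v N L M w lam kap + twoCouplingEnergy v N L M w 0 0 +
                  ENNReal.ofReal (ε * kap) :=
  fun _ _ _ hM hL _ hw1 v _ hΦw hΦE hfloor => DownSandwich.deepWallGerm_at hM hL hw1 v hΦw hΦE hfloor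

end Summit.AtomisticToContinuum.BoseEinsteinCondensation.Cruxes.LatticeToPeriodicBridge.MuffinTinRewardSupermodularity

end
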